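import Summits.AtomisticToContinuum.Crystallization.Theorems.OverbindingBudgetAffineFirmGainA
import Summits.AtomisticToContinuum.Crystallization.Theorems.FrustratedLawDichotomyNashStabilityCalculus

/-!
# `FirmGain` PROVED — file B: L2 `mixedDiffBound` (two nested mean-value bounds) and L3 `pairSumIdentity` (Finset induction on the family)
(line 31280, (2c) payer leaf `…OverbindingBudgetAffineFirmDescent.FirmGain` ((464) p864425); lens-4 BRIEF-g106 / NOTE-g107, proofs `FirmGainProved.lean`
63368a6f… §4–§5 VERBATIM; landing plan crit-1 r1950 (476), landed by hand-2 g51).  Imports file A (475) (vocabulary, the five statements, glue, L1, L4) and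
`…FrustratedLawDichotomyNashStabilityCalculus`; theorems only; 0 sorry; file C (477) closes with L5, the assembly and `firmGain`.  `--supports stmt-AtomisticToContinuum-31280`.
-/

namespace Summit.AtomisticToContinuum.Crystallization.Theorems.OverbindingBudgetAffineFirmDescent.Brief

open scoped BigOperators Classical RealInnerProductSpace
open Literature.MathematicalPhysics.StatisticalMechanics
open Literature.Geometry.DiscreteGeometry (nearestDist nearestDist_nonneg nearestDist_le_dist)
open Summit.AtomisticToContinuum.Crystallization.Theorems.OverbindingBudgetMisfitWindowStatements (InWindow offCount)
open Summit.AtomisticToContinuum.Crystallization.Theorems.OverbindingBudgetBalancedCensusStatements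
open Summit.AtomisticToContinuum.Crystallization.Theorems.OverbindingBudgetAffineTwinCut
open Summit.AtomisticToContinuum.Crystallization.Theorems.OverbindingBudgetAffineFirmDescent
open Summit.AtomisticToContinuum.Crystallization.Theorems.FrustratedLawDichotomyNashStabilityCalculus

variable {N : ℕ}

/-! ## §4  L2 `MixedDiffBound` -/

/-- The pointwise bound on the inner derivative: for `|x| ≥ m ≥ 1`,
`|G″(|x|²)·2⟨x,e⟩·2⟨x,u⟩ + G′(|x|²)·2⟨e,u⟩| ≤ 24 m⁻⁸ |u| |e|`. [S] -/
theorem inner_deriv_bound {x u e : EuclideanSpace ℝ (Fin 3)} {m : ℝ} (hm : 1 ≤ m) (hx : m ≤ ‖x‖) :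
    |((7 / 2 : ℝ) * (‖x‖ ^ 2)⁻¹ ^ 8 - 2 * (‖x‖ ^ 2)⁻¹ ^ 5) * (2 * ⟪x, e⟫) * (2 * ⟪x, u⟫)
        + (-(1 / 2 : ℝ) * (‖x‖ ^ 2)⁻¹ ^ 7 + (1 / 2 : ℝ) * (‖x‖ ^ 2)⁻¹ ^ 4) * (2 * ⟪e, u⟫)|
      ≤ 24 * m⁻¹ ^ 8 * ‖u‖ * ‖e‖ := by
  have hm0 : 0 < m := by linarith
  have hxpos : 0 < ‖x‖ := hm0.trans_le hx
  have h0 : 0 ≤ ‖x‖⁻¹ := inv_nonneg.2 hxpos.le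
  have hx1 : ‖x‖⁻¹ ≤ 1 := inv_le_one_of_one_le₀ (hm.trans hx)
  have hxm : ‖x‖⁻¹ ≤ m⁻¹ := inv_anti₀ hm0 hx
  have hie : |⟪x, e⟫| ≤ ‖x‖ * ‖e‖ := abs_real_inner_le_norm x e
  have hiu : |⟪x, u⟫| ≤ ‖x‖ * ‖u‖ := abs_real_inner_le_norm x u
  have heu : |⟪e, u⟫| ≤ ‖e‖ * ‖u‖ := abs_real_inner_le_norm e u
  have hrew : ((7 / 2 : ℝ) * (‖x‖ ^ 2)⁻¹ ^ 8 - 2 * (‖x‖ ^ 2)⁻¹ ^ 5) * (2 * ⟪x, e⟫) * (2 * ⟪x, u⟫)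
        + (-(1 / 2 : ℝ) * (‖x‖ ^ 2)⁻¹ ^ 7 + (1 / 2 : ℝ) * (‖x‖ ^ 2)⁻¹ ^ 4) * (2 * ⟪e, u⟫)
      = (14 * ‖x‖⁻¹ ^ 16 - 8 * ‖x‖⁻¹ ^ 10) * (⟪x, e⟫ * ⟪x, u⟫) + (-‖x‖⁻¹ ^ 14 + ‖x‖⁻¹ ^ 8) * ⟪e, u⟫ := by
    ring
  rw [hrew]
  have hsq : ‖x‖⁻¹ ^ 2 * ‖x‖ ^ 2 = 1 := by
    rw [← mul_pow, inv_mul_cancel₀ hxpos.ne', one_pow]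
  have hA : |(14 * ‖x‖⁻¹ ^ 16 - 8 * ‖x‖⁻¹ ^ 10) * (⟪x, e⟫ * ⟪x, u⟫)|
      ≤ (14 * ‖x‖⁻¹ ^ 14 + 8 * ‖x‖⁻¹ ^ 8) * (‖e‖ * ‖u‖) := by
    rw [abs_mul, abs_mul]
    have h1 : |14 * ‖x‖⁻¹ ^ 16 - 8 * ‖x‖⁻¹ ^ 10| ≤ 14 * ‖x‖⁻¹ ^ 16 + 8 * ‖x‖⁻¹ ^ 10 := by
      refine (abs_sub _ _).trans ?_
      rw [abs_of_nonneg (by positivity), abs_of_nonneg (by positivity)]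
    have h2 : |⟪x, e⟫| * |⟪x, u⟫| ≤ (‖x‖ * ‖e‖) * (‖x‖ * ‖u‖) :=
      mul_le_mul hie hiu (abs_nonneg _) (by positivity)
    calc |14 * ‖x‖⁻¹ ^ 16 - 8 * ‖x‖⁻¹ ^ 10| * (|⟪x, e⟫| * |⟪x, u⟫|)
        ≤ (14 * ‖x‖⁻¹ ^ 16 + 8 * ‖x‖⁻¹ ^ 10) * ((‖x‖ * ‖e‖) * (‖x‖ * ‖u‖)) :=
          mul_le_mul h1 h2 (by positivity) (by positivity)
      _ = (14 * ‖x‖⁻¹ ^ 14 + 8 * ‖x‖⁻¹ ^ 8) * (‖e‖ * ‖u‖) * (‖x‖⁻¹ ^ 2 * ‖x‖ ^ 2) := by ring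
      _ = (14 * ‖x‖⁻¹ ^ 14 + 8 * ‖x‖⁻¹ ^ 8) * (‖e‖ * ‖u‖) := by rw [hsq, mul_one]
  have hB : |(-‖x‖⁻¹ ^ 14 + ‖x‖⁻¹ ^ 8) * ⟪e, u⟫| ≤ (‖x‖⁻¹ ^ 14 + ‖x‖⁻¹ ^ 8) * (‖e‖ * ‖u‖) := by
    rw [abs_mul]
    have h1 : |-‖x‖⁻¹ ^ 14 + ‖x‖⁻¹ ^ 8| ≤ ‖x‖⁻¹ ^ 14 + ‖x‖⁻¹ ^ 8 := by
      refine (abs_add_le _ _).trans ?_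
      rw [abs_neg, abs_of_nonneg (by positivity), abs_of_nonneg (by positivity)]
    exact mul_le_mul h1 heu (abs_nonneg _) (by positivity)
  have h14 : ‖x‖⁻¹ ^ 14 ≤ ‖x‖⁻¹ ^ 8 := pow_le_pow_of_le_one h0 hx1 (by norm_num)
  have h8 : ‖x‖⁻¹ ^ 8 ≤ m⁻¹ ^ 8 := pow_le_pow_left₀ h0 hxm 8
  have heu0 : 0 ≤ ‖e‖ * ‖u‖ := by positivity
  calc |(14 * ‖x‖⁻¹ ^ 16 - 8 * ‖x‖⁻¹ ^ 10) * (⟪x, e⟫ * ⟪x, u⟫) + (-‖x‖⁻¹ ^ 14 + ‖x‖⁻¹ ^ 8) * ⟪e, u⟫|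
      ≤ |(14 * ‖x‖⁻¹ ^ 16 - 8 * ‖x‖⁻¹ ^ 10) * (⟪x, e⟫ * ⟪x, u⟫)| + |(-‖x‖⁻¹ ^ 14 + ‖x‖⁻¹ ^ 8) * ⟪e, u⟫| :=
        abs_add_le _ _
    _ ≤ (14 * ‖x‖⁻¹ ^ 14 + 8 * ‖x‖⁻¹ ^ 8) * (‖e‖ * ‖u‖) + (‖x‖⁻¹ ^ 14 + ‖x‖⁻¹ ^ 8) * (‖e‖ * ‖u‖) :=
        add_le_add hA hB
    _ = (15 * ‖x‖⁻¹ ^ 14 + 9 * ‖x‖⁻¹ ^ 8) * (‖e‖ * ‖u‖) := by ring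
    _ ≤ (24 * ‖x‖⁻¹ ^ 8) * (‖e‖ * ‖u‖) := mul_le_mul_of_nonneg_right (by linarith) heu0
    _ ≤ (24 * m⁻¹ ^ 8) * (‖e‖ * ‖u‖) := mul_le_mul_of_nonneg_right (by linarith) heu0
    _ = 24 * m⁻¹ ^ 8 * ‖u‖ * ‖e‖ := by ring

/-- The inner mean-value bound: for `H(t) = G′(|p + t e|²)·2⟨p + t e, u⟩` along a segment staying at norm `≥ m ≥ 1`,
`|H(1) − H(0)| ≤ 24 m⁻⁸ |u| |e|`. [M] -/
theorem inner_mvt (p u e : EuclideanSpace ℝ (Fin 3)) {m : ℝ} (hm : 1 ≤ m)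
    (hpath : ∀ t : ℝ, 0 ≤ t → t ≤ 1 → m ≤ ‖p + t • e‖) :
    |(-(1 / 2 : ℝ) * (‖p + (1 : ℝ) • e‖ ^ 2)⁻¹ ^ 7 + (1 / 2 : ℝ) * (‖p + (1 : ℝ) • e‖ ^ 2)⁻¹ ^ 4) * (2 * ⟪p + (1 : ℝ) • e, u⟫)
        - (-(1 / 2 : ℝ) * (‖p + (0 : ℝ) • e‖ ^ 2)⁻¹ ^ 7 + (1 / 2 : ℝ) * (‖p + (0 : ℝ) • e‖ ^ 2)⁻¹ ^ 4) * (2 * ⟪p + (0 : ℝ) • e, u⟫)|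
      ≤ 24 * m⁻¹ ^ 8 * ‖u‖ * ‖e‖ := by
  have hm0 : 0 < m := by linarith
  -- the derivative of `H`, as an opaque function with a defining equation
  obtain ⟨D, hD⟩ : ∃ D : ℝ → ℝ, ∀ t : ℝ, D t =
      (((7 / 2 : ℝ) * (‖p + t • e‖ ^ 2)⁻¹ ^ 8 - 2 * (‖p + t • e‖ ^ 2)⁻¹ ^ 5) * (2 * ⟪p + t • e, e⟫)) * (2 * ⟪p + t • e, u⟫)
        + (-(1 / 2 : ℝ) * (‖p + t • e‖ ^ 2)⁻¹ ^ 7 + (1 / 2 : ℝ) * (‖p + t • e‖ ^ 2)⁻¹ ^ 4) * (2 * ⟪e, u⟫) :=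
    ⟨fun t => (((7 / 2 : ℝ) * (‖p + t • e‖ ^ 2)⁻¹ ^ 8 - 2 * (‖p + t • e‖ ^ 2)⁻¹ ^ 5) * (2 * ⟪p + t • e, e⟫)) * (2 * ⟪p + t • e, u⟫)
        + (-(1 / 2 : ℝ) * (‖p + t • e‖ ^ 2)⁻¹ ^ 7 + (1 / 2 : ℝ) * (‖p + t • e‖ ^ 2)⁻¹ ^ 4) * (2 * ⟪e, u⟫), fun _ => rfl⟩
  have hH : ∀ t : ℝ, 0 ≤ t → t ≤ 1 → HasDerivAt
      (fun t : ℝ => (-(1 / 2 : ℝ) * (‖p + t • e‖ ^ 2)⁻¹ ^ 7 + (1 / 2 : ℝ) * (‖p + t • e‖ ^ 2)⁻¹ ^ 4) * (2 * ⟪p + t • e, u⟫))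
      (D t) t := by
    intro t ht0 ht1
    have hne : p + t • e ≠ 0 := by
      intro h
      have key := hpath t ht0 ht1
      rw [h, norm_zero] at key
      linarith
    have hfun : (fun t : ℝ => -(1 / 2 : ℝ) * (‖p + t • e‖ ^ 2)⁻¹ ^ 7 + (1 / 2 : ℝ) * (‖p + t • e‖ ^ 2)⁻¹ ^ 4) =
        (fun s : ℝ => -(1 / 2 : ℝ) * s⁻¹ ^ 7 + (1 / 2 : ℝ) * s⁻¹ ^ 4) ∘
          (fun t : ℝ => ‖p‖ ^ 2 + 2 * ⟪p, e⟫ * t + ‖e‖ ^ 2 * t ^ 2) := by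
      funext t
      simp only [Function.comp_apply]
      rw [norm_add_smul_sq]
    have hsq : ‖p‖ ^ 2 + 2 * ⟪p, e⟫ * t + ‖e‖ ^ 2 * t ^ 2 = ‖p + t • e‖ ^ 2 := (norm_add_smul_sq p e t).symm
    have hs : ‖p‖ ^ 2 + 2 * ⟪p, e⟫ * t + ‖e‖ ^ 2 * t ^ 2 ≠ 0 := by
      rw [hsq]
      exact pow_ne_zero 2 (norm_ne_zero_iff.2 hne)
    have hlin : 2 * ⟪p, e⟫ + 2 * ‖e‖ ^ 2 * t = 2 * ⟪p + t • e, e⟫ := by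
      rw [inner_add_left, real_inner_smul_left, real_inner_self_eq_norm_sq]
      ring
    have h1 : HasDerivAt
        (fun t : ℝ => -(1 / 2 : ℝ) * (‖p + t • e‖ ^ 2)⁻¹ ^ 7 + (1 / 2 : ℝ) * (‖p + t • e‖ ^ 2)⁻¹ ^ 4)
        (((7 / 2 : ℝ) * (‖p + t • e‖ ^ 2)⁻¹ ^ 8 - 2 * (‖p + t • e‖ ^ 2)⁻¹ ^ 5) * (2 * ⟪p + t • e, e⟫)) t := by
      rw [hfun]
      have key := (hasDerivAt_G' hs).comp t (hasDerivAt_phi p e t)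
      rw [hsq, hlin] at key
      exact key
    have h2 : HasDerivAt (fun t : ℝ => 2 * ⟪p + t • e, u⟫) (2 * ⟪e, u⟫) t := by
      have hfun2 : (fun t : ℝ => 2 * ⟪p + t • e, u⟫) = fun t : ℝ => 2 * ⟪p, u⟫ + 2 * ⟪e, u⟫ * t := by
        funext t
        rw [inner_add_left, real_inner_smul_left]
        ring
      rw [hfun2]
      have h3 : HasDerivAt (fun t : ℝ => 2 * ⟪e, u⟫ * t) (2 * ⟪e, u⟫ * 1) t := (hasDerivAt_id t).const_mul _
      refine ((hasDerivAt_const t (2 * ⟪p, u⟫)).add h3).congr_deriv ?_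
      ring
    rw [hD]
    exact h1.mul h2
  have hbound : ∀ t ∈ Set.Ico (0 : ℝ) 1, ‖D t‖ ≤ 24 * m⁻¹ ^ 8 * ‖u‖ * ‖e‖ := by
    intro t ht
    rw [hD, Real.norm_eq_abs]
    exact inner_deriv_bound hm (hpath t ht.1 ht.2.le)
  have hMVT := norm_image_sub_le_of_norm_deriv_le_segment_01'
    (f := fun t : ℝ => (-(1 / 2 : ℝ) * (‖p + t • e‖ ^ 2)⁻¹ ^ 7 + (1 / 2 : ℝ) * (‖p + t • e‖ ^ 2)⁻¹ ^ 4) * (2 * ⟪p + t • e, u⟫))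
    (fun t ht => (hH t ht.1 ht.2).hasDerivWithinAt) hbound
  rw [Real.norm_eq_abs] at hMVT
  exact hMVT

/-- **L2 · `MixedDiffBound`** (PROVED). -/
theorem mixedDiffBound : MixedDiffBound := by
  intro r u w m hm hr
  have hm0 : 0 < m := by linarith
  -- (i) every point of the parallelogram `r + s u − t w`, `s, t ∈ [0,1]`, has norm `≥ m`
  have hpar : ∀ s t : ℝ, 0 ≤ s → s ≤ 1 → 0 ≤ t → t ≤ 1 → m ≤ ‖r + s • u + t • (-w)‖ := by
    intro s t hs0 hs1 ht0 ht1
    have h1 : ‖r‖ ≤ ‖r + s • u + t • (-w)‖ + ‖s • u‖ + ‖t • (-w)‖ := by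
      have e1 : ‖r‖ = ‖(r + s • u + t • (-w)) - t • (-w) - s • u‖ := by
        congr 1
        abel
      rw [e1]
      have h2 := norm_sub_le ((r + s • u + t • (-w)) - t • (-w)) (s • u)
      have h3 := norm_sub_le (r + s • u + t • (-w)) (t • (-w))
      linarith
    have h2 : ‖s • u‖ ≤ ‖u‖ := by
      rw [norm_smul, Real.norm_eq_abs, abs_of_nonneg hs0]
      exact mul_le_of_le_one_left (norm_nonneg _) hs1
    have h3 : ‖t • (-w)‖ ≤ ‖w‖ := by
      rw [norm_smul, Real.norm_eq_abs, abs_of_nonneg ht0, norm_neg]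
      exact mul_le_of_le_one_left (norm_nonneg _) ht1
    linarith
  -- (ii) the outer function `s ↦ V(|r − w + s u|) − V(|r + s u|)` and its derivative
  obtain ⟨D, hD⟩ : ∃ D : ℝ → ℝ, ∀ s : ℝ, D s =
      (-(1 / 2 : ℝ) * (‖r - w + s • u - 0‖ ^ 2)⁻¹ ^ 7 + (1 / 2 : ℝ) * (‖r - w + s • u - 0‖ ^ 2)⁻¹ ^ 4)
          * (2 * ⟪r - w - 0, u⟫ + 2 * ‖u‖ ^ 2 * s)
        - (-(1 / 2 : ℝ) * (‖r + s • u - 0‖ ^ 2)⁻¹ ^ 7 + (1 / 2 : ℝ) * (‖r + s • u - 0‖ ^ 2)⁻¹ ^ 4)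
          * (2 * ⟪r - 0, u⟫ + 2 * ‖u‖ ^ 2 * s) :=
    ⟨fun s => (-(1 / 2 : ℝ) * (‖r - w + s • u - 0‖ ^ 2)⁻¹ ^ 7 + (1 / 2 : ℝ) * (‖r - w + s • u - 0‖ ^ 2)⁻¹ ^ 4)
          * (2 * ⟪r - w - 0, u⟫ + 2 * ‖u‖ ^ 2 * s)
        - (-(1 / 2 : ℝ) * (‖r + s • u - 0‖ ^ 2)⁻¹ ^ 7 + (1 / 2 : ℝ) * (‖r + s • u - 0‖ ^ 2)⁻¹ ^ 4)
          * (2 * ⟪r - 0, u⟫ + 2 * ‖u‖ ^ 2 * s), fun _ => rfl⟩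
  have hG : ∀ s : ℝ, 0 ≤ s → s ≤ 1 →
      HasDerivAt (fun s : ℝ => lennardJones (dist (r - w + s • u) 0) - lennardJones (dist (r + s • u) 0)) (D s) s := by
    intro s hs0 hs1
    have h1 : r - w + s • u ≠ 0 := by
      intro h
      have key := hpar s 1 hs0 hs1 zero_le_one le_rfl
      rw [one_smul, show r + s • u + -w = r - w + s • u by abel, h, norm_zero] at key
      linarith
    have h2 : r + s • u ≠ 0 := by
      intro h
      have key := hpar s 0 hs0 hs1 le_rfl zero_le_one
      rw [zero_smul, add_zero, h, norm_zero] at key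
      linarith
    rw [hD]
    exact (hasDerivAt_lennardJones_line h1).sub (hasDerivAt_lennardJones_line h2)
  -- (iii) the bound on the outer derivative, by the inner mean-value bound
  have hbound : ∀ s ∈ Set.Ico (0 : ℝ) 1, ‖D s‖ ≤ 24 * m⁻¹ ^ 8 * ‖u‖ * ‖w‖ := by
    intro s hs
    have hs0 : 0 ≤ s := hs.1
    have hs1 : s ≤ 1 := hs.2.le
    have hpath : ∀ t : ℝ, 0 ≤ t → t ≤ 1 → m ≤ ‖r + s • u + t • (-w)‖ := fun t ht0 ht1 => hpar s t hs0 hs1 ht0 ht1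
    have key := inner_mvt (r + s • u) u (-w) hm hpath
    rw [norm_neg] at key
    have ea : r - w + s • u - 0 = r + s • u + (1 : ℝ) • (-w) := by
      rw [sub_zero, one_smul]
      abel
    have eb : r + s • u - 0 = r + s • u + (0 : ℝ) • (-w) := by
      rw [sub_zero, zero_smul, add_zero]
    rw [hD, Real.norm_eq_abs, two_inner_line (r - w) 0 u s, two_inner_line r 0 u s, ea, eb]
    exact key
  -- (iv) the outer mean-value bound
  have hMVT := norm_image_sub_le_of_norm_deriv_le_segment_01'
    (f := fun s : ℝ => lennardJones (dist (r - w + s • u) 0) - lennardJones (dist (r + s • u) 0))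
    (fun s hs => (hG s hs.1 hs.2).hasDerivWithinAt) hbound
  simp only [one_smul, zero_smul, add_zero, dist_zero_right, Real.norm_eq_abs] at hMVT
  rw [show r - w + u = r + u - w by abel] at hMVT
  unfold mixedDiff
  rw [show lennardJones ‖r + u - w‖ - lennardJones ‖r + u‖ - lennardJones ‖r - w‖ + lennardJones ‖r‖
      = lennardJones ‖r + u - w‖ - lennardJones ‖r + u‖ - (lennardJones ‖r - w‖ - lennardJones ‖r‖) by ring]
  exact hMVT

/-! ## §5  L3 `PairSumIdentity` -/

/-- Membership in a support. [XS] -/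
theorem mem_supp {d : Fin N → EuclideanSpace ℝ (Fin 3)} {k : Fin N} : k ∈ supp d ↔ d k ≠ 0 := by
  simp [supp]

/-- `X(r; 0, q) = 0`. [XS] -/
theorem mixedDiff_zero_left (r q : EuclideanSpace ℝ (Fin 3)) : mixedDiff r 0 q = 0 := by
  simp [mixedDiff]

/-- `X(r; p, 0) = 0`. [XS] -/
theorem mixedDiff_zero_right (r p : EuclideanSpace ℝ (Fin 3)) : mixedDiff r p 0 = 0 := by
  simp [mixedDiff]

/-- **The pointwise identity.**  One ordered pair with relative position `r`; background moves `p` (first site), `q` (second site); member moves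
`u` (first), `v` (second); disjointness `u ≠ 0 → p = 0`, `v ≠ 0 → q = 0`.  Then
`V|r + (p+u) − (q+v)| − V|r + p − q| − (V|r + u − v| − V|r|) = X(r; u, q) + X(r; p, v)`. [S] -/
theorem pair_split (r p q u v : EuclideanSpace ℝ (Fin 3)) (hu : u ≠ 0 → p = 0) (hv : v ≠ 0 → q = 0) :
    lennardJones ‖r + (p + u) - (q + v)‖ - lennardJones ‖r + p - q‖ - (lennardJones ‖r + u - v‖ - lennardJones ‖r‖)
      = mixedDiff r u q + mixedDiff r p v := by
  by_cases hu0 : u = 0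
  · by_cases hv0 : v = 0
    · subst hu0; subst hv0
      simp only [mixedDiff, add_zero, sub_zero]
      ring
    · have hq : q = 0 := hv hv0
      subst hu0; subst hq
      simp only [mixedDiff, add_zero, sub_zero, zero_add]
      ring
  · have hp : p = 0 := hu hu0
    by_cases hv0 : v = 0
    · subst hp; subst hv0
      simp only [mixedDiff, add_zero, sub_zero, zero_add]
      ring
    · have hq : q = 0 := hv hv0
      subst hp; subst hq
      simp only [mixedDiff, add_zero, sub_zero, zero_add]
      ring

/-- **The insertion step.**  Adding one member move `u` on top of a background move `d` whose support misses `u`'s. [M] -/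
theorem insert_step (y d u : Fin N → EuclideanSpace ℝ (Fin 3)) (hdis : ∀ k : Fin N, u k ≠ 0 → d k = 0) :
    2 * (interactionEnergy lennardJones (y + d + u) - interactionEnergy lennardJones (y + d))
      - 2 * (interactionEnergy lennardJones (y + u) - interactionEnergy lennardJones y)
      = ∑ a, ∑ b, (mixedDiff (y a - y b) (u a) (d b) + mixedDiff (y a - y b) (d a) (u b)) := by
  rw [mul_sub, mul_sub, two_mul_interactionEnergy_eq_sum_sum lennardJones lennardJones_zero (y + d + u),
    two_mul_interactionEnergy_eq_sum_sum lennardJones lennardJones_zero (y + d),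
    two_mul_interactionEnergy_eq_sum_sum lennardJones lennardJones_zero (y + u),
    two_mul_interactionEnergy_eq_sum_sum lennardJones lennardJones_zero y]
  simp only [← Finset.sum_sub_distrib]
  refine Finset.sum_congr rfl fun a _ => Finset.sum_congr rfl fun b _ => ?_
  simp only [Pi.add_apply, dist_eq_norm]
  have h1 : y a + d a + u a - (y b + d b + u b) = (y a - y b) + (d a + u a) - (d b + u b) := by abel
  have h2 : y a + d a - (y b + d b) = (y a - y b) + d a - d b := by abel
  have h3 : y a + u a - (y b + u b) = (y a - y b) + u a - u b := by abel
  rw [h1, h2, h3]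
  exact pair_split (y a - y b) (d a) (d b) (u a) (u b) (hdis a) (hdis b)

/-- **L3 · `PairSumIdentity`** (PROVED). -/
theorem pairSumIdentity : PairSumIdentity := by
  intro N y F
  induction F using Finset.induction_on with
  | empty =>
    intro w _
    simp [crossSum]
  | @insert j₀ F' hj₀ IH =>
    intro w hdisj
    -- notation-free abbreviations
    have hdisj' : ∀ j ∈ F', ∀ j' ∈ F', j ≠ j' → ∀ k : Fin N, w j k = 0 ∨ w j' k = 0 :=
      fun j hj j' hj' hne k => hdisj j (Finset.mem_insert_of_mem hj) j' (Finset.mem_insert_of_mem hj') hne k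
    have IH' := IH w hdisj'
    have hne0 : ∀ j ∈ F', j₀ ≠ j := fun j hj h => hj₀ (h ▸ hj)
    -- the background move `d = Σ_{F'} w j` at a site: one member's move or zero
    have hval : ∀ k : Fin N, ∀ j ∈ F', w j k ≠ 0 → (∑ i ∈ F', w i) k = w j k := by
      intro k j hj hk
      rw [Finset.sum_apply]
      exact Finset.sum_eq_single_of_mem j hj (fun j' hj' hne => (hdisj' j hj j' hj' (Ne.symm hne) k).resolve_left hk)
    have hzero : ∀ k : Fin N, (∀ j ∈ F', w j k = 0) → (∑ i ∈ F', w i) k = 0 := by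
      intro k h
      rw [Finset.sum_apply]
      exact Finset.sum_eq_zero h
    -- `u = w j₀` misses the background
    have hud : ∀ k : Fin N, w j₀ k ≠ 0 → (∑ i ∈ F', w i) k = 0 := by
      intro k hk
      refine hzero k fun j hj => ?_
      exact (hdisj j₀ (Finset.mem_insert_self j₀ F') j (Finset.mem_insert_of_mem hj) (hne0 j hj) k).resolve_left hk
    have step := insert_step y (∑ i ∈ F', w i) (w j₀) hud
    -- the partner finset of the background and its disjointness
    have hpd : Set.PairwiseDisjoint (↑F' : Set (Fin N)) (fun j => supp (w j)) := by
      intro j₁ hj₁ j₂ hj₂ hne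
      show Disjoint (supp (w j₁)) (supp (w j₂))
      rw [Finset.disjoint_left]
      intro k hk1 hk2
      rcases hdisj' j₁ hj₁ j₂ hj₂ hne k with h | h
      · exact (mem_supp.1 hk1) h
      · exact (mem_supp.1 hk2) h
    have hBzero : ∀ k : Fin N, k ∉ F'.biUnion (fun j => supp (w j)) → (∑ i ∈ F', w i) k = 0 := by
      intro k hk
      refine hzero k fun j hj => ?_
      by_contra h
      exact hk (Finset.mem_biUnion.mpr ⟨j, hj, mem_supp.2 h⟩)
    -- block (I): `Σ_a Σ_b X(y_a − y_b; u_a, d_b) = Σ_{j'∈F'} Σ_{a∈supp u} Σ_{b∈supp (w j')} X(y_a − y_b; u_a, w_{j'} b)`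
    have hI : (∑ a, ∑ b, mixedDiff (y a - y b) (w j₀ a) ((∑ i ∈ F', w i) b))
        = ∑ j' ∈ F', ∑ a ∈ supp (w j₀), ∑ b ∈ supp (w j'), mixedDiff (y a - y b) (w j₀ a) (w j' b) := by
      -- restrict `a` to `supp u`
      have ha : (∑ a, ∑ b, mixedDiff (y a - y b) (w j₀ a) ((∑ i ∈ F', w i) b))
          = ∑ a ∈ supp (w j₀), ∑ b, mixedDiff (y a - y b) (w j₀ a) ((∑ i ∈ F', w i) b) := by
        symm
        refine Finset.sum_subset (Finset.subset_univ _) fun a _ ha => ?_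
        have : w j₀ a = 0 := by
          by_contra h
          exact ha (mem_supp.2 h)
        rw [this]
        exact Finset.sum_eq_zero fun b _ => mixedDiff_zero_left _ _
      rw [ha]
      -- for each `a`: restrict `b` to the partner finset, split by member, identify `d b = w j' b`
      have hb : ∀ a : Fin N, (∑ b, mixedDiff (y a - y b) (w j₀ a) ((∑ i ∈ F', w i) b))
          = ∑ j' ∈ F', ∑ b ∈ supp (w j'), mixedDiff (y a - y b) (w j₀ a) (w j' b) := by
        intro a
        have h1 : (∑ b, mixedDiff (y a - y b) (w j₀ a) ((∑ i ∈ F', w i) b))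
            = ∑ b ∈ F'.biUnion (fun j => supp (w j)), mixedDiff (y a - y b) (w j₀ a) ((∑ i ∈ F', w i) b) := by
          symm
          refine Finset.sum_subset (Finset.subset_univ _) fun b _ hb => ?_
          rw [hBzero b hb]
          exact mixedDiff_zero_right _ _
        rw [h1, Finset.sum_biUnion hpd]
        refine Finset.sum_congr rfl fun j' hj' => Finset.sum_congr rfl fun b hb => ?_
        rw [hval b j' hj' (mem_supp.1 hb)]
      simp only [hb]
      rw [Finset.sum_comm]
    -- block (II): `Σ_a Σ_b X(y_a − y_b; d_a, u_b) = Σ_{j∈F'} Σ_{a∈supp (w j)} Σ_{b∈supp u} X(y_a − y_b; w_j a, u_b)`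
    have hII : (∑ a, ∑ b, mixedDiff (y a - y b) ((∑ i ∈ F', w i) a) (w j₀ b))
        = ∑ j ∈ F', ∑ a ∈ supp (w j), ∑ b ∈ supp (w j₀), mixedDiff (y a - y b) (w j a) (w j₀ b) := by
      -- restrict `b` to `supp u` (inner sum)
      have hb : ∀ a : Fin N, (∑ b, mixedDiff (y a - y b) ((∑ i ∈ F', w i) a) (w j₀ b))
          = ∑ b ∈ supp (w j₀), mixedDiff (y a - y b) ((∑ i ∈ F', w i) a) (w j₀ b) := by
        intro a
        symm
        refine Finset.sum_subset (Finset.subset_univ _) fun b _ hb => ?_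
        have : w j₀ b = 0 := by
          by_contra h
          exact hb (mem_supp.2 h)
        rw [this]
        exact mixedDiff_zero_right _ _
      simp only [hb]
      -- restrict `a` to the partner finset, split by member, identify `d a = w j a`
      have h1 : (∑ a, ∑ b ∈ supp (w j₀), mixedDiff (y a - y b) ((∑ i ∈ F', w i) a) (w j₀ b))
          = ∑ a ∈ F'.biUnion (fun j => supp (w j)), ∑ b ∈ supp (w j₀), mixedDiff (y a - y b) ((∑ i ∈ F', w i) a) (w j₀ b) := by
        symm
        refine Finset.sum_subset (Finset.subset_univ _) fun a _ ha => ?_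
        rw [hBzero a ha]
        exact Finset.sum_eq_zero fun b _ => mixedDiff_zero_left _ _
      rw [h1, Finset.sum_biUnion hpd]
      refine Finset.sum_congr rfl fun j hj => Finset.sum_congr rfl fun a ha => Finset.sum_congr rfl fun b _ => ?_
      rw [hval a j hj (mem_supp.1 ha)]
    -- `crossSum (insert j₀ F') = blocks + crossSum F'`
    have hcross : crossSum y w (insert j₀ F')
        = (∑ j' ∈ F', ∑ a ∈ supp (w j₀), ∑ b ∈ supp (w j'), mixedDiff (y a - y b) (w j₀ a) (w j' b))
          + (∑ j ∈ F', ∑ a ∈ supp (w j), ∑ b ∈ supp (w j₀), mixedDiff (y a - y b) (w j a) (w j₀ b))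
          + crossSum y w F' := by
      unfold crossSum
      rw [Finset.sum_insert hj₀, Finset.erase_insert hj₀]
      have hinner : ∀ j ∈ F', (∑ j' ∈ (insert j₀ F').erase j, ∑ a ∈ supp (w j), ∑ b ∈ supp (w j'), mixedDiff (y a - y b) (w j a) (w j' b))
          = (∑ a ∈ supp (w j), ∑ b ∈ supp (w j₀), mixedDiff (y a - y b) (w j a) (w j₀ b))
            + ∑ j' ∈ F'.erase j, ∑ a ∈ supp (w j), ∑ b ∈ supp (w j'), mixedDiff (y a - y b) (w j a) (w j' b) := by
        intro j hj
        have hj₀' : j₀ ∉ F'.erase j := fun h => hj₀ (Finset.mem_of_mem_erase h)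
        rw [Finset.erase_insert_of_ne (hne0 j hj), Finset.sum_insert hj₀']
      rw [Finset.sum_congr rfl hinner, Finset.sum_add_distrib]
      ring
    -- assemble
    have e : y + ∑ j ∈ insert j₀ F', w j = y + ∑ i ∈ F', w i + w j₀ := by
      rw [Finset.sum_insert hj₀]
      abel
    rw [e, Finset.sum_insert hj₀, hcross, ← hI, ← hII]
    have step' : 2 * (interactionEnergy lennardJones (y + ∑ i ∈ F', w i + w j₀) - interactionEnergy lennardJones (y + ∑ i ∈ F', w i))
        - 2 * (interactionEnergy lennardJones (y + w j₀) - interactionEnergy lennardJones y)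
        = (∑ a, ∑ b, mixedDiff (y a - y b) (w j₀ a) ((∑ i ∈ F', w i) b))
          + ∑ a, ∑ b, mixedDiff (y a - y b) ((∑ i ∈ F', w i) a) (w j₀ b) := by
      rw [step, ← Finset.sum_add_distrib]
      refine Finset.sum_congr rfl fun a _ => ?_
      rw [← Finset.sum_add_distrib]
    linarith [IH', step']

end Summit.AtomisticToContinuum.Crystallization.Theorems.OverbindingBudgetAffineFirmDescent.Brief
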